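import Summits.MatrixMultiplication.MatrixMultiplication.Theorems.SubgroupIdentityDesigns.Negative.KernelLaw

/-!
# Witness pair bound `|H₁|·|H₂| ≤ p²(p-1)` for two p-members (negative lemmas for the crux
# `SubgroupIdentityDesigns`, stmt-MatrixMultiplication-14079) — VALUE = THEOREM (all p), NOT
# summit progress; the crux stays open.

The KERNEL LAW (`KernelLaw.kernel_law_frame`) in injective form: in a Borel frame of a
subgroup-TPP triple with a level-1 identity test, one of the two coordinate characters is
INJECTIVE on the diagonal data `{diag(a)diag(b)}` (`kernel_law_injective_frame`).  Counting along
the Bruhat big cell `U⁺·T·U⁻` then gives the census law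

  **(L-n2)**  subgroup-TPP, `p ∣ |H₁|`, `p ∣ |H₂|`, level-1 identity test  ⇒  `|H₁|·|H₂| ≤ p²(p-1)`

(`pair_card_le_of_idTest`, and `pair_card_le_of_levelOne_design` in the crux's vocabulary) — a
factor `p - 1` below the hypothesis-free two-Sylow packing law `p²(p-1)²`
(`TwoSylowLaw.disjoint_product_le`), valid for every prime `p`, no Dickson, no congruences.  The
frame survivor (`|K₁||K₂| = 4p²`) and every frame with `|T₁||T₂| > p - 1` violate it.
Honest scope: a CONSTRAINT on witnesses; frames with `D` cyclic and injective in one coordinate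
(`|T₁||T₂| ≤ p - 1`, e.g. same-corner coprime decorations) remain for the third-member analysis.
-/

set_option linter.dupNamespace false

noncomputable section

open scoped BigOperators Classical
open Summit.MatrixMultiplication.MatrixMultiplication.Theorems.LieRankDesigns.Negative
  (GLm Mat fourierFn)
open Summit.MatrixMultiplication.MatrixMultiplication.Theorems.LevelOneGL2Designs.Negative
  (levelSubmodule)

namespace Summit.MatrixMultiplication.MatrixMultiplication.Theorems.SubgroupIdentityDesigns.Negative

section WitnessPairBound

open Literature.Barriers.MatrixMultiplication (SubgroupTPP)

variable {p : ℕ} [hp : Fact p.Prime]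

/-- Diagonal entries of an upper-triangular invertible matrix are non-zero. -/
theorem diag_ne_zero_of_upper {k : GLm p 2} (hk10 : (k : Mat p 2) 1 0 = 0) :
    (k : Mat p 2) 0 0 ≠ 0 ∧ (k : Mat p 2) 1 1 ≠ 0 := by
  have h := Matrix.GeneralLinearGroup.det_ne_zero k
  rw [Matrix.det_fin_two, hk10, mul_zero, sub_zero] at h
  exact ⟨left_ne_zero_of_mul h, right_ne_zero_of_mul h⟩

/-- Diagonal entries of a lower-triangular invertible matrix are non-zero. -/
theorem diag_ne_zero_of_lower {k : GLm p 2} (hk01 : (k : Mat p 2) 0 1 = 0) :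
    (k : Mat p 2) 0 0 ≠ 0 ∧ (k : Mat p 2) 1 1 ≠ 0 := by
  have h := Matrix.GeneralLinearGroup.det_ne_zero k
  rw [Matrix.det_fin_two, hk01, zero_mul, sub_zero] at h
  exact ⟨left_ne_zero_of_mul h, right_ne_zero_of_mul h⟩

/-- Inverse of an element with a diagonal matrix. -/
theorem coe_inv_of_diag {t : GLm p 2} {x₀ x₁ : ZMod p} (ht : (t : Mat p 2) = !![x₀, 0; 0, x₁]) :
    ((t⁻¹ : GLm p 2) : Mat p 2) = !![x₀⁻¹, 0; 0, x₁⁻¹] := by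
  have hx : x₀ ≠ 0 ∧ x₁ ≠ 0 := by
    have h := Matrix.GeneralLinearGroup.det_ne_zero t
    rw [ht, Matrix.det_fin_two_of, mul_zero, sub_zero] at h
    exact ⟨left_ne_zero_of_mul h, right_ne_zero_of_mul h⟩
  obtain ⟨s, hs⟩ : ∃ s : GLm p 2, (s : Mat p 2) = !![x₀⁻¹, 0; 0, x₁⁻¹] :=
    ⟨Matrix.GeneralLinearGroup.mkOfDetNeZero _ (by
      rw [Matrix.det_fin_two_of]; simpa using ⟨hx.1, hx.2⟩), rfl⟩
  have hts : t * s = 1 := by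
    apply Units.ext
    rw [coe_mul_of_diag ht hs, Units.val_one, mul_inv_cancel₀ hx.1, mul_inv_cancel₀ hx.2]
    ext i j; fin_cases i <;> fin_cases j <;> simp
  rw [← hs, ← inv_eq_of_mul_eq_one_right hts]

/-- **KERNEL LAW, injective form (frame version).**  One coordinate character is injective on
the diagonal data: `a₁₁b₁₁ = a'₁₁b'₁₁ ⇒ a₀₀b₀₀ = a'₀₀b'₀₀` for all `a, a' ∈ H₁`, `b, b' ∈ H₂`, or
the same with the two coordinates exchanged. -/
theorem kernel_law_injective_frame {H₁ H₂ H₃ : Subgroup (GLm p 2)} (htpp : SubgroupTPP H₁ H₂ H₃)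
    (hB₁ : ∀ k ∈ H₁, (k : Mat p 2) 1 0 = 0)
    (hU₁ : ∀ u : GLm p 2, (u : Mat p 2) 1 0 = 0 → (u : Mat p 2) 0 0 = 1 → (u : Mat p 2) 1 1 = 1 →
      u ∈ H₁)
    (hB₂ : ∀ k ∈ H₂, (k : Mat p 2) 0 1 = 0)
    (hU₂ : ∀ v : GLm p 2, (v : Mat p 2) 0 1 = 0 → (v : Mat p 2) 0 0 = 1 → (v : Mat p 2) 1 1 = 1 →
      v ∈ H₂)
    (hdesign : ∃ f ∈ levelSubmodule p 2 1, f 1 = 1 ∧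
      ∀ a ∈ H₁, ∀ b ∈ H₂, ∀ c ∈ H₃, a * b * c ≠ 1 → f (a * b * c) = 0) :
    (∀ a ∈ H₁, ∀ a' ∈ H₁, ∀ b ∈ H₂, ∀ b' ∈ H₂,
        (a : Mat p 2) 1 1 * (b : Mat p 2) 1 1 = (a' : Mat p 2) 1 1 * (b' : Mat p 2) 1 1 →
        (a : Mat p 2) 0 0 * (b : Mat p 2) 0 0 = (a' : Mat p 2) 0 0 * (b' : Mat p 2) 0 0) ∨
      (∀ a ∈ H₁, ∀ a' ∈ H₁, ∀ b ∈ H₂, ∀ b' ∈ H₂,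
        (a : Mat p 2) 0 0 * (b : Mat p 2) 0 0 = (a' : Mat p 2) 0 0 * (b' : Mat p 2) 0 0 →
        (a : Mat p 2) 1 1 * (b : Mat p 2) 1 1 = (a' : Mat p 2) 1 1 * (b' : Mat p 2) 1 1) := by
  -- common preparation: the quotient elements `x = ta⁻¹ ta' ∈ H₁`, `y = tb' tb⁻¹ ∈ H₂`
  have key : ∀ a ∈ H₁, ∀ a' ∈ H₁, ∀ b ∈ H₂, ∀ b' ∈ H₂, ∃ x ∈ H₁, ∃ y ∈ H₂,
      (x : Mat p 2) 0 0 * (y : Mat p 2) 0 0 =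
        ((a : Mat p 2) 0 0)⁻¹ * (a' : Mat p 2) 0 0 *
          ((b' : Mat p 2) 0 0 * ((b : Mat p 2) 0 0)⁻¹) ∧
      (x : Mat p 2) 1 1 * (y : Mat p 2) 1 1 =
        ((a : Mat p 2) 1 1)⁻¹ * (a' : Mat p 2) 1 1 *
          ((b' : Mat p 2) 1 1 * ((b : Mat p 2) 1 1)⁻¹) := by
    intro a ha a' ha' b hb b' hb'
    obtain ⟨ta, hta, hta'⟩ := exists_diag_mem_of_upper hU₁ ha (hB₁ a ha)
    obtain ⟨ta', hta2, hta2'⟩ := exists_diag_mem_of_upper hU₁ ha' (hB₁ a' ha')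
    obtain ⟨tb, htb, htb'⟩ := exists_diag_mem_of_lower hU₂ hb (hB₂ b hb)
    obtain ⟨tb', htb2, htb2'⟩ := exists_diag_mem_of_lower hU₂ hb' (hB₂ b' hb')
    have hx := coe_mul_of_diag (coe_inv_of_diag hta') hta2'
    have hy := coe_mul_of_diag htb2' (coe_inv_of_diag htb')
    refine ⟨ta⁻¹ * ta', H₁.mul_mem (H₁.inv_mem hta) hta2, tb' * tb⁻¹,
      H₂.mul_mem htb2 (H₂.inv_mem htb), ?_, ?_⟩
    · rw [hx, hy]; simp
    · rw [hx, hy]; simp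
  rcases kernel_law_frame htpp hB₁ hU₁ hB₂ hU₂ hdesign with h | h
  · left
    intro a ha a' ha' b hb b' hb' heq
    obtain ⟨x, hx, y, hy, hxy0, hxy1⟩ := key a ha a' ha' b hb b' hb'
    have ha11 := (diag_ne_zero_of_upper (hB₁ a ha)).2
    have hb11 := (diag_ne_zero_of_lower (hB₂ b hb)).2
    have ha00 := (diag_ne_zero_of_upper (hB₁ a ha)).1
    have hb00 := (diag_ne_zero_of_lower (hB₂ b hb)).1
    have h1 : (x : Mat p 2) 1 1 * (y : Mat p 2) 1 1 = 1 := by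
      rw [hxy1]
      have : ((a : Mat p 2) 1 1)⁻¹ * (a' : Mat p 2) 1 1 *
            ((b' : Mat p 2) 1 1 * ((b : Mat p 2) 1 1)⁻¹)
          = ((a' : Mat p 2) 1 1 * (b' : Mat p 2) 1 1) /
            ((a : Mat p 2) 1 1 * (b : Mat p 2) 1 1) := by
        field_simp
      rw [this, ← heq, div_self (mul_ne_zero ha11 hb11)]
    have h0 := h x hx y hy h1
    rw [hxy0] at h0
    have : (a' : Mat p 2) 0 0 * (b' : Mat p 2) 0 0 = (a : Mat p 2) 0 0 * (b : Mat p 2) 0 0 := by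
      have e := congrArg (fun z => (a : Mat p 2) 0 0 * (b : Mat p 2) 0 0 * z) h0
      simp only [mul_one] at e
      rw [← e]; field_simp
    exact this.symm
  · right
    intro a ha a' ha' b hb b' hb' heq
    obtain ⟨x, hx, y, hy, hxy0, hxy1⟩ := key a ha a' ha' b hb b' hb'
    have ha11 := (diag_ne_zero_of_upper (hB₁ a ha)).2
    have hb11 := (diag_ne_zero_of_lower (hB₂ b hb)).2
    have ha00 := (diag_ne_zero_of_upper (hB₁ a ha)).1
    have hb00 := (diag_ne_zero_of_lower (hB₂ b hb)).1
    have h0 : (x : Mat p 2) 0 0 * (y : Mat p 2) 0 0 = 1 := by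
      rw [hxy0]
      have : ((a : Mat p 2) 0 0)⁻¹ * (a' : Mat p 2) 0 0 *
            ((b' : Mat p 2) 0 0 * ((b : Mat p 2) 0 0)⁻¹)
          = ((a' : Mat p 2) 0 0 * (b' : Mat p 2) 0 0) /
            ((a : Mat p 2) 0 0 * (b : Mat p 2) 0 0) := by
        field_simp
      rw [this, ← heq, div_self (mul_ne_zero ha00 hb00)]
    have h1 := h x hx y hy h0
    rw [hxy1] at h1
    have : (a' : Mat p 2) 1 1 * (b' : Mat p 2) 1 1 = (a : Mat p 2) 1 1 * (b : Mat p 2) 1 1 := by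
      have e := congrArg (fun z => (a : Mat p 2) 1 1 * (b : Mat p 2) 1 1 * z) h1
      simp only [mul_one] at e
      rw [← e]; field_simp
    exact this.symm

/-- Product formula for an upper-triangular times a lower-triangular element (Bruhat big cell):
the product is determined by `(a₀₁/a₁₁, b₁₀/b₁₁, a₀₀b₀₀, a₁₁b₁₁)`. -/
theorem coe_mul_upper_lower {a b : GLm p 2} (ha10 : (a : Mat p 2) 1 0 = 0)
    (hb01 : (b : Mat p 2) 0 1 = 0) :
    ((a * b : GLm p 2) : Mat p 2) =
      !![(a : Mat p 2) 0 0 * (b : Mat p 2) 0 0 +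
          ((a : Mat p 2) 0 1 / (a : Mat p 2) 1 1) * ((b : Mat p 2) 1 0 / (b : Mat p 2) 1 1) *
            ((a : Mat p 2) 1 1 * (b : Mat p 2) 1 1),
        ((a : Mat p 2) 0 1 / (a : Mat p 2) 1 1) * ((a : Mat p 2) 1 1 * (b : Mat p 2) 1 1);
        ((b : Mat p 2) 1 0 / (b : Mat p 2) 1 1) * ((a : Mat p 2) 1 1 * (b : Mat p 2) 1 1),
        (a : Mat p 2) 1 1 * (b : Mat p 2) 1 1] := by
  have ha11 := (diag_ne_zero_of_upper ha10).2
  have hb11 := (diag_ne_zero_of_lower hb01).2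
  rw [Units.val_mul]
  ext i j
  fin_cases i <;> fin_cases j <;> simp [Matrix.mul_apply, Fin.sum_univ_two, ha10, hb01]
  · field_simp
  · field_simp
  · field_simp

/-- **Counting along the big cell.**  In a Borel frame, two disjoint subgroups whose diagonal data
is injective in one coordinate satisfy `|H₁|·|H₂| ≤ p²(p-1)`. -/
theorem pair_card_le_frame {H₁ H₂ : Subgroup (GLm p 2)} (hd : Disjoint H₁ H₂)
    (hB₁ : ∀ k ∈ H₁, (k : Mat p 2) 1 0 = 0) (hB₂ : ∀ k ∈ H₂, (k : Mat p 2) 0 1 = 0)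
    (hinj : (∀ a ∈ H₁, ∀ a' ∈ H₁, ∀ b ∈ H₂, ∀ b' ∈ H₂,
        (a : Mat p 2) 1 1 * (b : Mat p 2) 1 1 = (a' : Mat p 2) 1 1 * (b' : Mat p 2) 1 1 →
        (a : Mat p 2) 0 0 * (b : Mat p 2) 0 0 = (a' : Mat p 2) 0 0 * (b' : Mat p 2) 0 0) ∨
      (∀ a ∈ H₁, ∀ a' ∈ H₁, ∀ b ∈ H₂, ∀ b' ∈ H₂,
        (a : Mat p 2) 0 0 * (b : Mat p 2) 0 0 = (a' : Mat p 2) 0 0 * (b' : Mat p 2) 0 0 →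
        (a : Mat p 2) 1 1 * (b : Mat p 2) 1 1 = (a' : Mat p 2) 1 1 * (b' : Mat p 2) 1 1)) :
    Nat.card H₁ * Nat.card H₂ ≤ p ^ 2 * (p - 1) := by
  -- the injective coordinate `i` and the recovery of both diagonal products from it
  have hrec : ∃ i : Fin 2, ∀ a ∈ H₁, ∀ a' ∈ H₁, ∀ b ∈ H₂, ∀ b' ∈ H₂,
      (a : Mat p 2) i i * (b : Mat p 2) i i = (a' : Mat p 2) i i * (b' : Mat p 2) i i →
      (a : Mat p 2) 0 0 * (b : Mat p 2) 0 0 = (a' : Mat p 2) 0 0 * (b' : Mat p 2) 0 0 ∧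
        (a : Mat p 2) 1 1 * (b : Mat p 2) 1 1 = (a' : Mat p 2) 1 1 * (b' : Mat p 2) 1 1 := by
    rcases hinj with h | h
    · exact ⟨1, fun a ha a' ha' b hb b' hb' e => ⟨h a ha a' ha' b hb b' hb' e, e⟩⟩
    · exact ⟨0, fun a ha a' ha' b hb b' hb' e => ⟨e, h a ha a' ha' b hb b' hb' e⟩⟩
  obtain ⟨i, hi⟩ := hrec
  have hii : ∀ a ∈ H₁, ∀ b ∈ H₂, (a : Mat p 2) i i * (b : Mat p 2) i i ≠ 0 := by
    intro a ha b hb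
    have h1 := diag_ne_zero_of_upper (hB₁ a ha)
    have h2 := diag_ne_zero_of_lower (hB₂ b hb)
    fin_cases i
    · exact mul_ne_zero h1.1 h2.1
    · exact mul_ne_zero h1.2 h2.2
  let Ψ : H₁ × H₂ → ZMod p × ZMod p × (ZMod p)ˣ := fun q =>
    (((q.1 : GLm p 2) : Mat p 2) 0 1 / ((q.1 : GLm p 2) : Mat p 2) 1 1,
      ((q.2 : GLm p 2) : Mat p 2) 1 0 / ((q.2 : GLm p 2) : Mat p 2) 1 1,
      Units.mk0 (((q.1 : GLm p 2) : Mat p 2) i i * ((q.2 : GLm p 2) : Mat p 2) i i)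
        (hii _ q.1.2 _ q.2.2))
  have hΨ : Function.Injective Ψ := by
    rintro ⟨⟨a, ha⟩, ⟨b, hb⟩⟩ ⟨⟨a', ha'⟩, ⟨b', hb'⟩⟩ e
    simp only [Ψ, Prod.mk.injEq, Units.mk0_inj] at e
    obtain ⟨e1, e2, e3⟩ := e
    obtain ⟨f0, f1⟩ := hi a ha a' ha' b hb b' hb' e3
    have hab : a * b = a' * b' := by
      apply Units.ext
      rw [coe_mul_upper_lower (hB₁ a ha) (hB₂ b hb), coe_mul_upper_lower (hB₁ a' ha') (hB₂ b' hb'),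
        e1, e2, f0, f1]
    have hq : a'⁻¹ * a = b' * b⁻¹ := by
      rw [inv_mul_eq_iff_eq_mul, ← mul_assoc, eq_mul_inv_iff_mul_eq, hab]
    have m1 : a'⁻¹ * a ∈ H₁ := H₁.mul_mem (H₁.inv_mem ha') ha
    have m2 : a'⁻¹ * a ∈ H₂ := by rw [hq]; exact H₂.mul_mem hb' (H₂.inv_mem hb)
    have u := Subgroup.disjoint_def.1 hd m1 m2
    have ja : a' = a := inv_mul_eq_one.mp u
    have jb : b' = b := mul_inv_eq_one.mp (by rw [← hq, u])
    subst ja; subst jb; rfl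
  calc Nat.card H₁ * Nat.card H₂ = Nat.card (H₁ × H₂) := (Nat.card_prod _ _).symm
    _ ≤ Nat.card (ZMod p × ZMod p × (ZMod p)ˣ) := Nat.card_le_card_of_injective Ψ hΨ
    _ = p ^ 2 * (p - 1) := by
      rw [Nat.card_prod, Nat.card_prod, natCard_units, Nat.card_zmod]; ring

/-- **(L-n2) WITNESS PAIR BOUND.**  A subgroup-TPP triple of `GL_2(𝔽_p)` with `p ∣ |H₁|`,
`p ∣ |H₂|` and a level-1 identity test satisfies `|H₁|·|H₂| ≤ p²(p-1)` — every prime `p`. -/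
theorem pair_card_le_of_idTest {H₁ H₂ H₃ : Subgroup (GLm p 2)} (htpp : SubgroupTPP H₁ H₂ H₃)
    (h₁ : p ∣ Nat.card H₁) (h₂ : p ∣ Nat.card H₂)
    (hdesign : ∃ f ∈ levelSubmodule p 2 1, f 1 = 1 ∧
      ∀ a ∈ H₁, ∀ b ∈ H₂, ∀ c ∈ H₃, a * b * c ≠ 1 → f (a * b * c) = 0) :
    Nat.card H₁ * Nat.card H₂ ≤ p ^ 2 * (p - 1) := by
  obtain ⟨c, hB₁, hU₁, hB₂, hU₂, htpp'⟩ := exists_borel_frame_of_tpp htpp h₁ h₂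
  have hinj := kernel_law_injective_frame htpp' hB₁ hU₁ hB₂ hU₂ (idTest_map_conj c hdesign)
  have hd' := (StandardLines.subgroupTPP_disjoint htpp').1
  have h := pair_card_le_frame hd' hB₁ hB₂ hinj
  rwa [Subgroup.card_map_of_injective (MulAut.conj c⁻¹).injective,
    Subgroup.card_map_of_injective (MulAut.conj c⁻¹).injective] at h

/-- **(L-n2) in the crux's vocabulary.**  If `(H₁, H₂, H₃)` is subgroup-TPP with `p ∣ |H₁|`,
`p ∣ |H₂|` and satisfies the identity-design clause of `SubgroupIdentityDesigns` at level `1`,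
then `|H₁|·|H₂| ≤ p²(p-1)`.  (Compare the design-free law `p²(p-1)²` of `TwoSylowLaw`.) -/
theorem pair_card_le_of_levelOne_design {H₁ H₂ H₃ : Subgroup (GLm p 2)}
    (htpp : SubgroupTPP H₁ H₂ H₃) (h₁ : p ∣ Nat.card H₁) (h₂ : p ∣ Nat.card H₂)
    (hdesign : ∃ c : Mat p 2 → ℂ, (∀ M, 1 < M.rank → c M = 0) ∧
      (∑ M, c M * ZMod.stdAddChar (Matrix.trace (M * ((1 : GLm p 2) : Mat p 2)))) = 1 ∧
      ∀ a ∈ H₁, ∀ b ∈ H₂, ∀ g ∈ H₃, a * b * g ≠ 1 →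
        (∑ M, c M *
          ZMod.stdAddChar (Matrix.trace (M * ((a * b * g : GLm p 2) : Mat p 2)))) = 0) :
    Nat.card H₁ * Nat.card H₂ ≤ p ^ 2 * (p - 1) := by
  obtain ⟨c, hc, hc1, hc0⟩ := hdesign
  exact pair_card_le_of_idTest htpp h₁ h₂
    ⟨fourierFn c, LevelOneGL2Designs.Negative.fourierFn_mem_levelSubmodule hc, hc1,
      fun a ha b hb g hg hne => hc0 a ha b hb g hg hne⟩

/-- **Volume form.**  Under the same hypotheses `V = |H₁||H₂||H₃| ≤ p²(p-1)·|H₃|`. -/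
theorem volume_le_of_levelOne_design {H₁ H₂ H₃ : Subgroup (GLm p 2)}
    (htpp : SubgroupTPP H₁ H₂ H₃) (h₁ : p ∣ Nat.card H₁) (h₂ : p ∣ Nat.card H₂)
    (hdesign : ∃ c : Mat p 2 → ℂ, (∀ M, 1 < M.rank → c M = 0) ∧
      (∑ M, c M * ZMod.stdAddChar (Matrix.trace (M * ((1 : GLm p 2) : Mat p 2)))) = 1 ∧
      ∀ a ∈ H₁, ∀ b ∈ H₂, ∀ g ∈ H₃, a * b * g ≠ 1 →
        (∑ M, c M *
          ZMod.stdAddChar (Matrix.trace (M * ((a * b * g : GLm p 2) : Mat p 2)))) = 0) :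
    Nat.card H₁ * Nat.card H₂ * Nat.card H₃ ≤ p ^ 2 * (p - 1) * Nat.card H₃ :=
  Nat.mul_le_mul_right _ (pair_card_le_of_levelOne_design htpp h₁ h₂ hdesign)

end WitnessPairBound

end Summit.MatrixMultiplication.MatrixMultiplication.Theorems.SubgroupIdentityDesigns.Negative

end
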